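import Literature.NumberTheory.EllipticCurves.GreenbergSelmerNewform
import Literature.NumberTheory.EllipticCurves.Newforms
import Mathlib.NumberTheory.Padics.Complex
import Mathlib.NumberTheory.Padics.HeightOneSpectrum
import HarnessLib

/-!
# The integral ordinary datum `(K, 𝒪, π, ρ_f, A_f')` of a `p`-adically embedded newform (EPW §3.1)

Emerton–Pollack–Weston, *Variation of Iwasawa invariants in Hida families*, Invent. Math. 163
(2006), §3.1 (arXiv:math/0404484, p. 17 of the held text), VERBATIM: "Let `f = ∑ aₙqⁿ` be a
`p`-ordinary and `p`-stabilized newform of weight `k ≥ 2`, tame level `N`, and character `χ`. Let `K`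
denote the finite extension of `ℚ_p` generated by the Fourier coefficients of `f` and let `𝒪` denote
the ring of integers of `K`; we write `k` for the residue field and fix also a uniformizer `π` of `𝒪`.
Let `ρ_f : G_ℚ → GL₂(K)` be the corresponding Galois representation, characterized by the fact that
the characteristic polynomial under `ρ_f` of an arithmetic Frobenius at a prime `ℓ ∤ Np` is
`X² − a_ℓ X + χ(ℓ)ℓ^{k−1}`. By [GS] the restriction of `ρ_f` to `G_p` is of the form
`ρ|_{G_p} ≅ (ε^{k−1}χφ⁻¹ ∗ ; 0 φ)` [(eq:ordes)] with `φ : G_p → 𝒪^×` the unramified character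
sending an arithmetic Frobenius to `a_p`. We assume that the semisimple residual representation
`ρ̄_f : G_ℚ → GL₂(k)` is absolutely irreducible. It follows that, up to conjugation by `GL₂(𝒪)`,
there is a unique integral model `ρ_f : G_ℚ → GL₂(𝒪)` of `ρ_f`, which we now fix."

This file (part 3 of the (V-alg) vocabulary of the BSD residual cell,
`run/shared/lean/b2b/bsd-rank1-residual/b2b-bsdres-x11a/GL2-VOCAB-SPEC.md`; parts 1–2 =
`GreenbergSelmer.lean`, `GreenbergSelmerNewform.lean`) packages EPW's data for a NEWFORM
`g ∈ S_k(Γ₀(M))` (trivial character, `p ∤ M`) with a `p`-adic embedding `ι : K_g → ℚ̄_p` of its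
coefficient field — the `p`-stabilisation `f = g(z) − (a_p − υ)g(pz)` of `g` being EPW's `f` — in
the vocabulary of parts 1–2, so that published statements about `Sel(ℚ_∞, A_f)`, `μ^alg(f)`,
`λ^alg(f)` can be typed against it:

* `padicCoeffField ι = K = ℚ_p(ι(K_g)) ⊆ ℚ̄_p` (an `IntermediateField ℚ_[p] (PadicAlgCl p)`; it
  contains the unit root `υ`, the root of `X² − ι(a_p)X + p^{k−1}` of norm `1`, by Hensel, so it IS
  EPW's `K` for the stabilisation `f`);
* `padicCoeffIntegers ι = 𝒪 = {x ∈ K : |x|_p ≤ 1}` (a `Subring K`; the ambient norm of `ℚ̄_p`),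
  with `padicCoeffIntegers.toPadicAlgCl ι : 𝒪 →+* ℚ̄_p`;
* the structure **`OrdinaryNewformDatum g p ι`** = `(ρ, (A'_v)_{v ∣ p}, π)`: a framed Galois
  representation `ρ : Γ_ℚ → GL₂(𝒪)` ATTACHED to `(g, ι)` (unramified at every `ℓ ∤ Mp` with
  arithmetic-Frobenius characteristic polynomial mapping to `X² − ι(a_ℓ(g))X + ℓ^{k−1}` in
  `ℚ̄_p[X]` — the convention of `ModularForms.IsGaloisRepOfNewform1Int`, stated directly for the
  `Γ₀(M)`-form `g`), an ordinary filtration `OrdinaryFiltration ρ v` (part 2: a `D_v`-stable rank-one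
  direct summand with unramified quotient = (eq:ordes)) at every place `v` of `ℚ` above `p`, and a
  uniformiser `π` of `𝒪` (`|π| < 1` and `π ∣ x` whenever `|x| < 1`);
* for such a datum `Δ`: `Δ.plus` (the plus-parts), `Δ.selmer κ = Sel(ℚ_∞, A_f)` (part 2's
  `greenbergSelmer` with `F = K`, `A_f = K²/𝒪² = Cofree ρ K`), `Δ.selmerTorsion κ = Sel(ℚ_∞, A_f)[π]`
  and `Δ.torsionDim κ = dim_k Sel(ℚ_∞, A_f)[π]` (part 2's `greenbergSelmerTorsionBy`,
  `selmerTorsionDim`), for a `ℤ_p`-extension `κ` of `ℚ` (the cyclotomic one).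

Everything is a definition with a body or a structure; NOTHING is asserted. In particular the
EXISTENCE of a datum (Deligne's representation with an `𝒪`-lattice; the ordinary filtration for
`|ι(a_p)| = 1`, Wiles, Invent. Math. 94 (1988) Thm. 2.2 / EPW's "[GS]"; a uniformiser, `K/ℚ_p` being
finite) is NOT asserted here, and neither are EPW Thm. 3.1.1 (cotorsion, `μ^alg = 0 ⟺ Sel[π]`
finite, `λ^alg = dim_k Sel[π]`) nor the uniqueness of the integral model. Statements consume
`Δ : OrdinaryNewformDatum g p ι` as a universally quantified hypothesis; when `ρ̄` is absolutely
irreducible all choices of `ρ` are `GL₂(𝒪)`-conjugate (EPW, loc. cit.), and `μ^alg = 0` /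
`λ^alg` do not depend on the choice of `K ⊇ ℚ_p(a_n(f))` either (a finite extension `𝒪'/𝒪` is
free, `Sel(A ⊗_𝒪 𝒪') ≅ Sel(A) ⊗_𝒪 𝒪'`, and `Sel(A) ≅ (K/𝒪)^{λ}` as `𝒪`-modules when `μ = 0`,
EPW proof of Thm. 3.1.1) — here `K` is pinned to `ℚ_p(ι(K_g))` anyway.

## References

* M. Emerton, R. Pollack, T. Weston, Invent. Math. 163 (2006), §3.1 (p. 17), Thm. 3.1.1.
  [EmertonPollackWeston2006]
* R. Greenberg, *Iwasawa theory for p-adic representations*, Adv. Stud. Pure Math. 17 (1989), §1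
  p. 98. [Greenberg1989]
* A. Wiles, Invent. Math. 94 (1988), Thm. 2.2. [Wiles1988]
-/

noncomputable section

open scoped Classical MatrixGroups ModularForm NumberField

open CongruenceSubgroup IsDedekindDomain Field UpperHalfPlane
open Literature.NumberTheory.GaloisRepresentations
open Literature.NumberTheory.EllipticCurves.ModularForms

namespace Literature.NumberTheory.EllipticCurves.GreenbergSelmer

/-! ## `K = ℚ_p(ι K_g)` and its ring of integers -/

section Coefficients

variable {Γ : Subgroup (GL (Fin 2) ℝ)} {k : ℤ} {g : CuspForm Γ k} {p : ℕ} [Fact p.Prime]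

/-- **`K = ℚ_p(ι(K_g)) ⊆ ℚ̄_p`**: the subfield of `ℚ̄_p` generated over `ℚ_p` by the image of the
coefficient field `K_g = ℚ(aₙ(g))` under the embedding `ι` — EPW §3.1 "`K` the finite extension of
`ℚ_p` generated by the Fourier coefficients of `f`" (for the `p`-stabilisation `f` of `g` the
coefficients `aₙ(f)` generate the same field, the unit root lying in it by Hensel's lemma).
[cite: EmertonPollackWeston2006, §3.1 (p. 17)] -/
def padicCoeffField (ι : coeffField g →+* PadicAlgCl p) : IntermediateField ℚ_[p] (PadicAlgCl p) :=
  IntermediateField.adjoin ℚ_[p] (Set.range ι)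

/-- `ι(x) ∈ K` for every `x ∈ K_g`. [cite: EmertonPollackWeston2006, §3.1 (p. 17)] -/
theorem map_mem_padicCoeffField (ι : coeffField g →+* PadicAlgCl p) (x : coeffField g) :
    ι x ∈ padicCoeffField ι :=
  IntermediateField.subset_adjoin ℚ_[p] _ ⟨x, rfl⟩

/-- **`𝒪 = {x ∈ K : |x|_p ≤ 1}`**, the ring of integers of `K = ℚ_p(ι(K_g))` (closed under `+` by
the ultrametric inequality of `ℚ̄_p`), as a subring of `K` — EPW §3.1 "`𝒪` the ring of integers of
`K`". [cite: EmertonPollackWeston2006, §3.1 (p. 17)] -/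
def padicCoeffIntegers (ι : coeffField g →+* PadicAlgCl p) : Subring (padicCoeffField ι) where
  carrier := {x | ‖(x : PadicAlgCl p)‖ ≤ 1}
  mul_mem' {a b} ha hb := by
    change ‖((a * b : padicCoeffField ι) : PadicAlgCl p)‖ ≤ 1
    rw [show ((a * b : padicCoeffField ι) : PadicAlgCl p) = (a : PadicAlgCl p) * b from rfl,
      norm_mul]
    exact mul_le_one₀ ha (norm_nonneg _) hb
  one_mem' := by
    change ‖((1 : padicCoeffField ι) : PadicAlgCl p)‖ ≤ 1
    simp
  add_mem' {a b} ha hb := by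
    change ‖((a + b : padicCoeffField ι) : PadicAlgCl p)‖ ≤ 1
    rw [show ((a + b : padicCoeffField ι) : PadicAlgCl p) = (a : PadicAlgCl p) + b from rfl]
    exact (IsUltrametricDist.norm_add_le_max _ _).trans (max_le ha hb)
  zero_mem' := by
    change ‖((0 : padicCoeffField ι) : PadicAlgCl p)‖ ≤ 1
    simp
  neg_mem' {a} ha := by
    change ‖((-a : padicCoeffField ι) : PadicAlgCl p)‖ ≤ 1
    rw [show ((-a : padicCoeffField ι) : PadicAlgCl p) = -(a : PadicAlgCl p) from rfl, norm_neg]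
    exact ha

/-- Membership in `𝒪`: `|x|_p ≤ 1`. [cite: EmertonPollackWeston2006, §3.1 (p. 17)] -/
theorem mem_padicCoeffIntegers_iff (ι : coeffField g →+* PadicAlgCl p) (x : padicCoeffField ι) :
    x ∈ padicCoeffIntegers ι ↔ ‖(x : PadicAlgCl p)‖ ≤ 1 :=
  Iff.rfl

/-- The inclusion `𝒪 → ℚ̄_p` (through `K`). [cite: EmertonPollackWeston2006, §3.1 (p. 17)] -/
def padicCoeffIntegers.toPadicAlgCl (ι : coeffField g →+* PadicAlgCl p) :
    padicCoeffIntegers ι →+* PadicAlgCl p :=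
  (algebraMap (padicCoeffField ι) (PadicAlgCl p)).comp (padicCoeffIntegers ι).subtype

/-- Unfolding `toPadicAlgCl`: it is the coercion `𝒪 ⊆ K ⊆ ℚ̄_p`. [cite: EmertonPollackWeston2006, §3.1 (p. 17)] -/
@[simp]
theorem padicCoeffIntegers.toPadicAlgCl_apply (ι : coeffField g →+* PadicAlgCl p)
    (x : padicCoeffIntegers ι) :
    padicCoeffIntegers.toPadicAlgCl ι x = ((x : padicCoeffField ι) : PadicAlgCl p) :=
  rfl

/-- Elements of `𝒪` have norm `≤ 1` in `ℚ̄_p`. [cite: EmertonPollackWeston2006, §3.1 (p. 17)] -/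
theorem norm_toPadicAlgCl_le_one (ι : coeffField g →+* PadicAlgCl p) (x : padicCoeffIntegers ι) :
    ‖padicCoeffIntegers.toPadicAlgCl ι x‖ ≤ 1 :=
  x.2

end Coefficients

/-! ## The datum -/

section Datum

variable {M : ℕ} {k : ℤ}

/-- **An integral ordinary datum `(ρ_f, (A'_v)_{v ∣ p}, π)` for the `p`-adically embedded newform
`(g, ι)`** — EPW §3.1's fixed data for the `p`-stabilisation `f` of `g ∈ S_k(Γ₀(M))` (trivial
character), over `𝒪 = padicCoeffIntegers ι`:
* `ρ : Γ_ℚ → GL₂(𝒪)` continuous, ATTACHED to `(g, ι)`: for every finite place `v` of `ℚ` whose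
  prime `ℓ` satisfies `ℓ ∤ M` and `ℓ ≠ p`, `ρ` is unramified at `v` and every arithmetic Frobenius
  at `v` has characteristic polynomial `P ∈ 𝒪[X]` mapping to `X² − ι(a_ℓ(g)) X + ℓ^{k−1}` in
  `ℚ̄_p[X]` ("characterized by the fact that the characteristic polynomial under `ρ_f` of an
  arithmetic Frobenius at a prime `ℓ ∤ Np` is `X² − a_ℓX + χ(ℓ)ℓ^{k−1}`", `χ = 1`; the shape of
  `ModularForms.IsGaloisRepOfNewform1Int`, rational primes ↔ `HeightOneSpectrum (𝓞 ℚ)` by Mathlib's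
  `Rat.HeightOneSpectrum.primesEquiv`);
* `fil v hv : OrdinaryFiltration ρ v` at each `v ∋ p` — the sub `A'_f` of (eq:ordes) (`D_v`-stable
  rank-one direct summand `T⁺ ≤ 𝒪²` with unramified quotient; for `k ≥ 2` this pins the line
  `ε^{k−1}φ⁻¹`, the other stable line in the split case having the ramified quotient `ε^{k−1}φ⁻¹`);
* `ϖ` a uniformiser of `𝒪`: `|ϖ|_p < 1` and `ϖ ∣ x` for every `x ∈ 𝒪` with `|x|_p < 1`.
A hypothesis structure: its EXISTENCE (Deligne; Wiles 1988 Thm. 2.2 = EPW's "[GS]"; finiteness of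
`K/ℚ_p`) is not asserted, and statements take `Δ : OrdinaryNewformDatum g p ι` as a binder.
[cite: EmertonPollackWeston2006, §3.1 (p. 17), (eq:ordes)] [cite: Wiles1988, Thm. 2.2] -/
structure OrdinaryNewformDatum (g : CuspForm (Gamma0 M) k) (p : ℕ) [Fact p.Prime]
    (ι : coeffField g →+* PadicAlgCl p) where
  /-- The integral model `ρ_f : Γ_ℚ → GL₂(𝒪)`. -/
  ρ : FramedGaloisRep ℚ (padicCoeffIntegers ι) 2
  /-- `ρ` is attached to `(g, ι)`: unramified at `ℓ ∤ Mp` with arithmetic-Frobenius characteristic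
  polynomial `X² − ι(a_ℓ(g))X + ℓ^{k−1}`. -/
  charpoly : ∀ v : HeightOneSpectrum (𝓞 ℚ),
    ¬ ((Rat.HeightOneSpectrum.primesEquiv v : Nat.Primes) : ℕ) ∣ M →
    ((Rat.HeightOneSpectrum.primesEquiv v : Nat.Primes) : ℕ) ≠ p →
    ρ.IsUnramifiedAt v ∧
      ∃ P : Polynomial (padicCoeffIntegers ι),
        P.map (padicCoeffIntegers.toPadicAlgCl ι) =
          Polynomial.X ^ 2
            - Polynomial.C (ι ⟨(qExpansion 1 ⇑g).coeff
                ((Rat.HeightOneSpectrum.primesEquiv v : Nat.Primes) : ℕ),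
                coeff_mem_coeffField g _⟩) * Polynomial.X
            + Polynomial.C ((((Rat.HeightOneSpectrum.primesEquiv v : Nat.Primes) : ℕ) :
                PadicAlgCl p) ^ (k - 1).toNat) ∧
        ρ.HasFrobCharpolyAt v P
  /-- The ordinary filtration (eq:ordes) at the places above `p`. -/
  fil : ∀ v : HeightOneSpectrum (𝓞 ℚ), ((p : ℕ) : 𝓞 ℚ) ∈ v.asIdeal → OrdinaryFiltration ρ v
  /-- A uniformiser `π` of `𝒪` … -/
  ϖ : padicCoeffIntegers ι
  /-- … of norm `< 1` … -/
  norm_ϖ_lt_one : ‖padicCoeffIntegers.toPadicAlgCl ι ϖ‖ < 1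
  /-- … dividing every element of norm `< 1`. -/
  dvd_of_norm_lt_one : ∀ x : padicCoeffIntegers ι, ‖padicCoeffIntegers.toPadicAlgCl ι x‖ < 1 → ϖ ∣ x

namespace OrdinaryNewformDatum

variable {g : CuspForm (Gamma0 M) k} {p : ℕ} [Fact p.Prime] {ι : coeffField g →+* PadicAlgCl p}
  (Δ : OrdinaryNewformDatum g p ι)

/-- The plus-parts `T⁺_v = A'_f ∩ T`, `v ∣ p`, of the datum (input of part 2's `greenbergSelmer`).
[cite: EmertonPollackWeston2006, §3.1 (p. 17), (eq:ordes)] -/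
def plus : ∀ v : HeightOneSpectrum (𝓞 ℚ), ((p : ℕ) : 𝓞 ℚ) ∈ v.asIdeal → PlusPart Δ.ρ v :=
  fun v hv ↦ (Δ.fil v hv).toPlusPart

/-- **`Sel(ℚ_∞, A_f)`** of EPW §3.1 for the datum, over the `ℤ_p`-extension `κ` (the cyclotomic
one): part 2's `greenbergSelmer K κ ρ (plus)` with `A_f = K²/𝒪² = Cofree ρ K`.
[cite: EmertonPollackWeston2006, §3.1 (p. 17)] -/
def selmer (κ : ZpExtension ℚ p) :
    AddSubgroup (subgroupH1 κ.kerSubgroup (Cofree Δ.ρ (padicCoeffField ι))) :=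
  greenbergSelmer (padicCoeffField ι) κ Δ.ρ Δ.plus

/-- **`Sel(ℚ_∞, A_f)[π]`** (EPW Thm. 3.1.1: finite iff `μ^alg(f) = 0` — not asserted).
[cite: EmertonPollackWeston2006, Thm. 3.1.1 (p. 17)] -/
def selmerTorsion (κ : ZpExtension ℚ p) :
    AddSubgroup (subgroupH1 κ.kerSubgroup (Cofree Δ.ρ (padicCoeffField ι))) :=
  greenbergSelmerTorsionBy (padicCoeffField ι) κ Δ.ρ Δ.plus Δ.ϖ

/-- **`dim_k Sel(ℚ_∞, A_f)[π]`** as `log_{#k} #Sel[π]` (EPW Thm. 3.1.1: `= λ^alg(f)` when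
`μ^alg(f) = 0` — not asserted). [cite: EmertonPollackWeston2006, Thm. 3.1.1 (p. 17)] -/
def torsionDim (κ : ZpExtension ℚ p) : ℕ :=
  selmerTorsionDim (padicCoeffField ι) κ Δ.ρ Δ.plus Δ.ϖ

/-- Unfolding `selmerTorsion`: it is `selmer ⊓ ker(π)`. [cite: EmertonPollackWeston2006, Thm. 3.1.1 (p. 17)] -/
theorem selmerTorsion_eq (κ : ZpExtension ℚ p) :
    Δ.selmerTorsion κ =
      Δ.selmer κ ⊓ (scalarH1 κ.kerSubgroup (Cofree Δ.ρ (padicCoeffField ι)) Δ.ϖ).ker :=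
  rfl

/-- `Sel[π] ≤ Sel`. [cite: EmertonPollackWeston2006, Thm. 3.1.1 (p. 17)] -/
theorem selmerTorsion_le (κ : ZpExtension ℚ p) : Δ.selmerTorsion κ ≤ Δ.selmer κ :=
  greenbergSelmerTorsionBy_le (padicCoeffField ι) κ Δ.ρ Δ.plus Δ.ϖ

/-- Unfolding `torsionDim`. [cite: EmertonPollackWeston2006, Thm. 3.1.1 (p. 17)] -/
theorem torsionDim_eq (κ : ZpExtension ℚ p) :
    Δ.torsionDim κ =
      Nat.log (Nat.card (padicCoeffIntegers ι ⧸ Ideal.span {Δ.ϖ}))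
        (Nat.card (Δ.selmerTorsion κ)) :=
  rfl

end OrdinaryNewformDatum

end Datum

end Literature.NumberTheory.EllipticCurves.GreenbergSelmer

end
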